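import Summits.KontsevichZagierPeriods.KontsevichZagierPeriods.Theorems.HurwitzMicroSectorsNormalFormPrincipleM3KernelRefs
import Summits.KontsevichZagierPeriods.KontsevichZagierPeriods.Theorems.HurwitzMicroSectorsNormalFormPrincipleM3KernelReduceZeta
import Summits.KontsevichZagierPeriods.KontsevichZagierPeriods.Theorems.HurwitzMicroSectorsNormalFormPrincipleM3KernelReduceLog
import Summits.KontsevichZagierPeriods.KontsevichZagierPeriods.Theorems.MzvKernelInKZ.Negative.ScalingDivision
import Literature.NumberTheory.Transcendental.AperyIrrationality

/-!
# `NormalFormPrinciple` (stmt-KontsevichZagierPeriods-3869), line `SketchIdeator1` —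
# leaf `stub_boxRigidity`, layer `M3` kernel: the UNCONDITIONAL sub-kernels

Pure proof file (lead seat c9; `--supports` the crux). The capstone
`m3Instances_mem_relations_of_eval_eq_zero` proves Conjecture 1 on the subgroup of eleven
dimension-three box families conditionally on `LinearIndependent ℚ ![ζ(3), π² log 2]`. On the two
"pure" sub-families no transcendence is needed at all: the six `ζ(3)`-valued families reduce to the
`ζ(3)` box alone and the three `π² log 2`-valued families to the product box `Q` alone, so a
vanishing value forces a vanishing integer coefficient as soon as the reference value is nonzero —
`zetaValue 3 > 0` (`zeta_three_pos`) and `π²/6 · log 2 > 0`. These are instances of the leaf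
`stub_boxRigidity` proved outright on infinite subgroups of the formal period group.
References: M. Kontsevich, D. Zagier, *Periods* (2001), §1.2 (Conjecture 1). No definitions are introduced.
-/

noncomputable section

open MeasureTheory Set
open Literature.NumberTheory.Transcendental Literature.NumberTheory.Transcendental.KZ
open Summit.KontsevichZagierPeriods.MzvKernelInKZ.Negative (mem_relations_of_nsmul_mem)

namespace Summit.KontsevichZagierPeriods.HurwitzMicroSectors.NormalFormPrinciple.PiBox.M3

/-- **Conjecture 1 UNCONDITIONALLY on the six `ζ(3)`-valued dimension-three box families** (lead
seat c9, line `SketchIdeator1`). Every `ℤ`-combination of representations of the families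
`[□³, 1/(1−xyz)]`, `[□³, 2/(1−xyz)]`, `[□³, 5/(1−xyz)]`, `[□³, 1/((1−xy)(1−xyz))]`,
`[□³, 8/((1+xy)(1+xyz))]`, `[□³, 16/((2−x)(2−xyz))]` whose value vanishes is a relation of the
Kontsevich–Zagier calculus — with NO transcendence hypothesis: each representative reduces (after
doubling) to an integer multiple of the `ζ(3)` box (`m3k_reduce_zeta`), and `ζ(3) > 0`.
[cite: KontsevichZagier2001, §1.2 Conjecture 1] -/
theorem m3ZetaFamilies_mem_relations_of_eval_eq_zero
    {c : FormalRep}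
    (hc : c ∈ AddSubgroup.closure
      ({y : FormalRep | ∃ N : IntegralRep 3, N.domain = {x | ∀ i, x i ∈ Set.Ioo (0:ℝ) 1} ∧
        EqOn N.integrand (fun x => 1 / (1 - x 0 * x 1 * x 2)) N.domain ∧ y = of N} ∪
      {y : FormalRep | ∃ N : IntegralRep 3, N.domain = {x | ∀ i, x i ∈ Set.Ioo (0:ℝ) 1} ∧
        EqOn N.integrand (fun x => 2 / (1 - x 0 * x 1 * x 2)) N.domain ∧ y = of N} ∪
      {y : FormalRep | ∃ N : IntegralRep 3, N.domain = {x | ∀ i, x i ∈ Set.Ioo (0:ℝ) 1} ∧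
        EqOn N.integrand (fun x => 5 / (1 - x 0 * x 1 * x 2)) N.domain ∧ y = of N} ∪
      {y : FormalRep | ∃ N : IntegralRep 3, N.domain = {x | ∀ i, x i ∈ Set.Ioo (0:ℝ) 1} ∧
        EqOn N.integrand (fun x => 1 / ((1 - x 0 * x 1) * (1 - x 0 * x 1 * x 2))) N.domain ∧ y = of N} ∪
      {y : FormalRep | ∃ N : IntegralRep 3, N.domain = {x | ∀ i, x i ∈ Set.Ioo (0:ℝ) 1} ∧
        EqOn N.integrand (fun x => 8 / ((1 + x 0 * x 1) * (1 + x 0 * x 1 * x 2))) N.domain ∧ y = of N} ∪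
      {y : FormalRep | ∃ N : IntegralRep 3, N.domain = {x | ∀ i, x i ∈ Set.Ioo (0:ℝ) 1} ∧
        EqOn N.integrand (fun x => 16 / ((2 - x 0) * (2 - x 0 * x 1 * x 2))) N.domain ∧ y = of N}))
    (hv : eval c = 0) : c ∈ relations := by
  obtain ⟨Z, Q, N7, ⟨hZd, hZi, hZv⟩, ⟨hQd, hQi, hQv⟩, ⟨hN7d, hN7i⟩⟩ := m3k_exists_refs
  obtain ⟨r10, r2, r4, r1, r3, r5⟩ := m3k_reduce_zeta Z Q N7 hZd hZi hQd hQi hN7d hN7i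
  have hred : ∀ c ∈ AddSubgroup.closure
      ({y : FormalRep | ∃ N : IntegralRep 3, N.domain = {x | ∀ i, x i ∈ Set.Ioo (0:ℝ) 1} ∧
        EqOn N.integrand (fun x => 1 / (1 - x 0 * x 1 * x 2)) N.domain ∧ y = of N} ∪
      {y : FormalRep | ∃ N : IntegralRep 3, N.domain = {x | ∀ i, x i ∈ Set.Ioo (0:ℝ) 1} ∧
        EqOn N.integrand (fun x => 2 / (1 - x 0 * x 1 * x 2)) N.domain ∧ y = of N} ∪
      {y : FormalRep | ∃ N : IntegralRep 3, N.domain = {x | ∀ i, x i ∈ Set.Ioo (0:ℝ) 1} ∧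
        EqOn N.integrand (fun x => 5 / (1 - x 0 * x 1 * x 2)) N.domain ∧ y = of N} ∪
      {y : FormalRep | ∃ N : IntegralRep 3, N.domain = {x | ∀ i, x i ∈ Set.Ioo (0:ℝ) 1} ∧
        EqOn N.integrand (fun x => 1 / ((1 - x 0 * x 1) * (1 - x 0 * x 1 * x 2))) N.domain ∧ y = of N} ∪
      {y : FormalRep | ∃ N : IntegralRep 3, N.domain = {x | ∀ i, x i ∈ Set.Ioo (0:ℝ) 1} ∧
        EqOn N.integrand (fun x => 8 / ((1 + x 0 * x 1) * (1 + x 0 * x 1 * x 2))) N.domain ∧ y = of N} ∪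
      {y : FormalRep | ∃ N : IntegralRep 3, N.domain = {x | ∀ i, x i ∈ Set.Ioo (0:ℝ) 1} ∧
        EqOn N.integrand (fun x => 16 / ((2 - x 0) * (2 - x 0 * x 1 * x 2))) N.domain ∧ y = of N}),
      ∃ α : ℤ, (2:ℕ) • c - α • of Z ∈ relations := by
    intro c hc
    induction hc using AddSubgroup.closure_induction with
    | mem y hy =>
      simp only [mem_union, mem_setOf_eq] at hy
      rcases hy with (((((⟨N, hNd, hNi, rfl⟩ | ⟨N, hNd, hNi, rfl⟩) | ⟨N, hNd, hNi, rfl⟩) | ⟨N, hNd, hNi, rfl⟩) | ⟨N, hNd, hNi, rfl⟩) | ⟨N, hNd, hNi, rfl⟩)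
      · exact ⟨2, by simpa only [zero_smul, add_zero] using r10 N hNd hNi⟩
      · exact ⟨4, by simpa only [zero_smul, add_zero] using r2 N hNd hNi⟩
      · exact ⟨10, by simpa only [zero_smul, add_zero] using r4 N hNd hNi⟩
      · exact ⟨4, by simpa only [zero_smul, add_zero] using r1 N hNd hNi⟩
      · exact ⟨10, by simpa only [zero_smul, add_zero] using r3 N hNd hNi⟩
      · exact ⟨10, by simpa only [zero_smul, add_zero] using r5 N hNd hNi⟩
    | zero =>
      refine ⟨0, ?_⟩
      simp only [smul_zero, zero_smul, sub_zero]
      exact relations.zero_mem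
    | add y z _ _ ihy ihz =>
      obtain ⟨α₁, h₁⟩ := ihy
      obtain ⟨α₂, h₂⟩ := ihz
      refine ⟨α₁ + α₂, ?_⟩
      have e : (2:ℕ) • (y + z) - (α₁ + α₂) • of Z =
          ((2:ℕ) • y - α₁ • of Z) + ((2:ℕ) • z - α₂ • of Z) := by
        simp only [smul_add, add_smul]; abel
      rw [e]
      exact relations.add_mem h₁ h₂
    | neg y _ ih =>
      obtain ⟨α, h⟩ := ih
      refine ⟨-α, ?_⟩
      have e : (2:ℕ) • (-y) - (-α) • of Z = -((2:ℕ) • y - α • of Z) := by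
        simp only [smul_neg, neg_smul]; abel
      rw [e]
      exact relations.neg_mem h
  obtain ⟨α, h⟩ := hred c hc
  have hev := relations_le_ker_eval_holds h
  rw [AddMonoidHom.mem_ker, map_sub, map_nsmul, map_zsmul, eval_of, hv, hZv, smul_zero,
    zero_sub, neg_eq_zero, zsmul_eq_mul, mul_eq_zero] at hev
  have hα : α = 0 := by
    rcases hev with h0 | h0
    · exact_mod_cast h0
    · exact absurd h0 (ne_of_gt Literature.NumberTheory.Transcendental.Apery.zeta_three_pos)
  subst hα
  simp only [zero_smul, sub_zero] at h
  exact mem_relations_of_nsmul_mem (by norm_num) h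

/-- **Conjecture 1 UNCONDITIONALLY on the three `π²·log 2`-valued dimension-three box families**
(lead seat c9, line `SketchIdeator1`): `[□³, 1/((1−xy)(1+z))]`, `[□³, 3/((1−xy)(1+z))]`,
`[□³, 4/((2−x)(1−xyz))]` — every `ℤ`-combination of representations with vanishing value is a
KZ relation (reductions `m3k_reduce_log` to the product box `Q` of value `π²/6 · log 2 ≠ 0`).
[cite: KontsevichZagier2001, §1.2 Conjecture 1] -/
theorem m3LogFamilies_mem_relations_of_eval_eq_zero
    {c : FormalRep}
    (hc : c ∈ AddSubgroup.closure
      ({y : FormalRep | ∃ N : IntegralRep 3, N.domain = {x | ∀ i, x i ∈ Set.Ioo (0:ℝ) 1} ∧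
        EqOn N.integrand (fun x => 1 / ((1 - x 0 * x 1) * (1 + x 2))) N.domain ∧ y = of N} ∪
      {y : FormalRep | ∃ N : IntegralRep 3, N.domain = {x | ∀ i, x i ∈ Set.Ioo (0:ℝ) 1} ∧
        EqOn N.integrand (fun x => 3 / ((1 - x 0 * x 1) * (1 + x 2))) N.domain ∧ y = of N} ∪
      {y : FormalRep | ∃ N : IntegralRep 3, N.domain = {x | ∀ i, x i ∈ Set.Ioo (0:ℝ) 1} ∧
        EqOn N.integrand (fun x => 4 / ((2 - x 0) * (1 - x 0 * x 1 * x 2))) N.domain ∧ y = of N}))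
    (hv : eval c = 0) : c ∈ relations := by
  obtain ⟨Z, Q, N7, ⟨hZd, hZi, hZv⟩, ⟨hQd, hQi, hQv⟩, ⟨hN7d, hN7i⟩⟩ := m3k_exists_refs
  obtain ⟨r11, r9, r8, -, -⟩ := m3k_reduce_log Z Q N7 hZd hZi hQd hQi hN7d hN7i
  have hred : ∀ c ∈ AddSubgroup.closure
      ({y : FormalRep | ∃ N : IntegralRep 3, N.domain = {x | ∀ i, x i ∈ Set.Ioo (0:ℝ) 1} ∧
        EqOn N.integrand (fun x => 1 / ((1 - x 0 * x 1) * (1 + x 2))) N.domain ∧ y = of N} ∪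
      {y : FormalRep | ∃ N : IntegralRep 3, N.domain = {x | ∀ i, x i ∈ Set.Ioo (0:ℝ) 1} ∧
        EqOn N.integrand (fun x => 3 / ((1 - x 0 * x 1) * (1 + x 2))) N.domain ∧ y = of N} ∪
      {y : FormalRep | ∃ N : IntegralRep 3, N.domain = {x | ∀ i, x i ∈ Set.Ioo (0:ℝ) 1} ∧
        EqOn N.integrand (fun x => 4 / ((2 - x 0) * (1 - x 0 * x 1 * x 2))) N.domain ∧ y = of N}),
      ∃ α : ℤ, (2:ℕ) • c - α • of Q ∈ relations := by
    intro c hc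
    induction hc using AddSubgroup.closure_induction with
    | mem y hy =>
      simp only [mem_union, mem_setOf_eq] at hy
      rcases hy with ((⟨N, hNd, hNi, rfl⟩ | ⟨N, hNd, hNi, rfl⟩) | ⟨N, hNd, hNi, rfl⟩)
      · exact ⟨2, by simpa only [zero_smul, zero_add] using r11 N hNd hNi⟩
      · exact ⟨6, by simpa only [zero_smul, zero_add] using r9 N hNd hNi⟩
      · exact ⟨6, by simpa only [zero_smul, zero_add] using r8 N hNd hNi⟩
    | zero =>
      refine ⟨0, ?_⟩
      simp only [smul_zero, zero_smul, sub_zero]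
      exact relations.zero_mem
    | add y z _ _ ihy ihz =>
      obtain ⟨α₁, h₁⟩ := ihy
      obtain ⟨α₂, h₂⟩ := ihz
      refine ⟨α₁ + α₂, ?_⟩
      have e : (2:ℕ) • (y + z) - (α₁ + α₂) • of Q =
          ((2:ℕ) • y - α₁ • of Q) + ((2:ℕ) • z - α₂ • of Q) := by
        simp only [smul_add, add_smul]; abel
      rw [e]
      exact relations.add_mem h₁ h₂
    | neg y _ ih =>
      obtain ⟨α, h⟩ := ih
      refine ⟨-α, ?_⟩
      have e : (2:ℕ) • (-y) - (-α) • of Q = -((2:ℕ) • y - α • of Q) := by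
        simp only [smul_neg, neg_smul]; abel
      rw [e]
      exact relations.neg_mem h
  obtain ⟨α, h⟩ := hred c hc
  have hev := relations_le_ker_eval_holds h
  rw [AddMonoidHom.mem_ker, map_sub, map_nsmul, map_zsmul, eval_of, hv, hQv, smul_zero,
    zero_sub, neg_eq_zero, zsmul_eq_mul, mul_eq_zero] at hev
  have hα : α = 0 := by
    rcases hev with h0 | h0
    · exact_mod_cast h0
    · exact absurd h0 (mul_pos (by positivity) (Real.log_pos one_lt_two)).ne'
  subst hα
  simp only [zero_smul, sub_zero] at h
  exact mem_relations_of_nsmul_mem (by norm_num) h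

end Summit.KontsevichZagierPeriods.HurwitzMicroSectors.NormalFormPrinciple.PiBox.M3
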